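import Summits.BirchSwinnertonDyer.BirchSwinnertonDyer.Theorems.PrintX11aUpperNonSurjFiveThreeCores
import Summits.BirchSwinnertonDyer.BirchSwinnertonDyer.Theorems.PrintX11aUpperNonSurjFiveExcShallowSector
import HarnessLib

/-!
# Route `PrintX11a`, crux U5 = `Theses.PrintX11a.UpperNonSurjFive` (item stmt-BirchSwinnertonDyer-20614), line of record «gl1cartan5» (REV 11):
# U5 BY NAME from UNIT + SHALLOW + EXC-SHALLOW + the three FLAT cores, the planner turnkey with the eleven named facts inlined, and exactness

Cell `bsd-print-x11a`, LEAD `cruxlead-stmt-BirchSwinnertonDyer-20614` g6 (`--supports stmt-BirchSwinnertonDyer-20614 --as helper`).  THEOREMS ONLY (no definition, no named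
fact minted, no `sorry`); imports the route file like its rev-10 twin `Theorems/PrintX11aUpperNonSurjFiveThreeCores.lean` (g5, p677750).  REV 11 of the line CUTS the
exceptional-zero core C_exc into the CLOSED exc-shallow sector «`p` split ∧ `ord_p ∏c ≤ 1` ∧ `Ш(E)[p] = 0`» (`Theorems.GL1Cartan.Exc.upperNonSurjFive_on_excShallowSector_of_facts`,
p686445: the exceptional-zero Tamagawa divisibility by level lowering at the finite prime `p`, modulo Coleman–Edixhoven / Greenberg–Vatsal / Ihara / Mazur / modularity /
the new `ribet1990_levelLowering_gamma0_newform_general_of_five_le` (p685873) / GZK) and the flat core C_exc♭ «`p` split ∧ (`Ш(E)[p] ≠ 0` ∨ `ord_p ∏c ≥ 2`)».  This file: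

* §1 `upperNonSurjFive_of_sectors_of_threeFlatCores` — fact-free glue BY NAME: UNIT → SHALLOW → EXC-SHALLOW → C_exc♭ → C_exp → C_tam ⟹ U5;
  `upperNonSurjFive_of_elevenFacts_of_threeFlatCores` — PLANNER TURNKEY: the eleven named facts + the three flat cores ⟹ U5 (UNIT, SHALLOW, EXC-SHALLOW inlined from
  their landed conditional theorems).
* §2 `upperNonSurjFive_iff_sectors_and_threeFlatCores` — exactness (each piece is U5 on a sub-locus; fact-free);
  `excZeroCore_iff_excShallow_and_flat` — rev 10's C_exc ⟺ EXC-SHALLOW ∧ C_exc♭ (fact-free), so rev 11 asks NO MORE of the future than rev 10.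

HONEST FRAMING: every positive statement is CONDITIONAL on the displayed named facts and on the OPEN flat cores; after rev 11 the open part of U5 is exactly
«`Ш(E)[p] ≠ 0`» ∪ «`ord_p ∏c ≥ 2`» (uniformly in the split ∕ non-split type of `p`): the walls «Euler-system bound at residual image `5S4`/`pNs`» and «level-lowering
congruence modulo `p²`», neither in print.  BSD is not proved by any of this; no statement of the summit is proved here; nothing bounds a non-trivial `Ш`.
[cite: Miller2011LMS, Def. 1.1 (arXiv:1010.2431 p. 3)] [cite: Kato2004Asterisque, §17.13 (pp. 279–280)] [cite: DarmonDiamondTaylor1995, Thm. 3.15]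
[cite: GreenbergVatsal2000, §3 (17)–(19)]
-/

set_option linter.dupNamespace false
set_option autoImplicit false

noncomputable section

open scoped Classical

open WeierstrassCurve
  Literature.NumberTheory.EllipticCurves
  Literature.NumberTheory.EllipticCurves.ModularForms
  Literature.NumberTheory.EllipticCurves.Rank1Residual
  Literature.NumberTheory.EllipticCurves.Rank1Residual.Typed
  Literature.NumberTheory.EllipticCurves.SteinWuthrich2013
  Literature.NumberTheory.EllipticCurves.Kato2004
  Summit.BirchSwinnertonDyer.Rank1Residual
  Summit.BirchSwinnertonDyer.BirchSwinnertonDyer.Theses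

namespace Summit.BirchSwinnertonDyer.BirchSwinnertonDyer.Theorems.GL1Cartan

/-! ## §1 Glue BY NAME (rev 11) and the planner turnkey -/

/-- **Glue (fact-free; rev 11 of the record): UNIT → SHALLOW → EXC-SHALLOW → C_exc♭ → C_exp → C_tam ⟹ U5 BY NAME** — C_exc of rev 10 is recovered from EXC-SHALLOW
and C_exc♭ by the case split «`ord_p ∏c ≤ 1` ∧ `Ш(E)[p] = 0`», then the rev-10 glue `upperNonSurjFive_of_unitSector_of_shallow_of_threeCores` applies.
[cite: Miller2011LMS, Def. 1.1 (arXiv:1010.2431 p. 3)] [cite: SilvermanATAEC1994, Cor. IV.9.2 (d)] -/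
theorem upperNonSurjFive_of_sectors_of_threeFlatCores
    (hU : ∀ (W : WeierstrassCurve ℚ) [W.IsElliptic] [W.IsGloballyMinimal] (p : ℕ) [Fact p.Prime],
      ClassX11a W p → ¬ Surj W p → 5 ≤ p → ¬ W.HasSplitMultiplicativeReductionAtPrime p →
      (∃ t : ℚ, W.entireLFunction 1 / (W.realPeriodRat : ℂ) = (t : ℂ) ∧ padicValRat p t = 0) →
      MissingUpperBoundAt W p)
    (hS : ∀ (W : WeierstrassCurve ℚ) [W.IsElliptic] [W.IsGloballyMinimal] (p : ℕ) [Fact p.Prime],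
      ClassX11a W p → ¬ Surj W p → 5 ≤ p → ¬ W.HasSplitMultiplicativeReductionAtPrime p →
      padicValNat p W.tamagawaProduct ≤ 1 → (∀ x : W.sha, (p : ℤ) • x = 0 → x = 0) → MissingUpperBoundAt W p)
    (hE : ∀ (W : WeierstrassCurve ℚ) [W.IsElliptic] [W.IsGloballyMinimal] (p : ℕ) [Fact p.Prime],
      ClassX11a W p → ¬ Surj W p → 5 ≤ p → W.HasSplitMultiplicativeReductionAtPrime p →
      padicValNat p W.tamagawaProduct ≤ 1 → (∀ x : W.sha, (p : ℤ) • x = 0 → x = 0) → MissingUpperBoundAt W p)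
    (hCe : ∀ (W : WeierstrassCurve ℚ) [W.IsElliptic] [W.IsGloballyMinimal] (p : ℕ) [Fact p.Prime],
      ClassX11a W p → ¬ Surj W p → 5 ≤ p → W.HasSplitMultiplicativeReductionAtPrime p →
      ((∃ x : W.sha, (p : ℤ) • x = 0 ∧ x ≠ 0) ∨ 2 ≤ padicValNat p W.tamagawaProduct) → MissingUpperBoundAt W p)
    (hCx : ∀ (W : WeierstrassCurve ℚ) [W.IsElliptic] [W.IsGloballyMinimal] (p : ℕ) [Fact p.Prime],
      ClassX11a W p → ¬ Surj W p → 5 ≤ p → ¬ W.HasSplitMultiplicativeReductionAtPrime p →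
      (∃ x : W.sha, (p : ℤ) • x = 0 ∧ x ≠ 0) →
      (∀ t : ℚ, W.entireLFunction 1 / (W.realPeriodRat : ℂ) = (t : ℂ) → padicValRat p t ≠ 0) →
      MissingUpperBoundAt W p)
    (hCt : ∀ (W : WeierstrassCurve ℚ) [W.IsElliptic] [W.IsGloballyMinimal] (p : ℕ) [Fact p.Prime],
      ClassX11a W p → ¬ Surj W p → 5 ≤ p → ¬ W.HasSplitMultiplicativeReductionAtPrime p →
      2 ≤ padicValNat p W.tamagawaProduct → (∀ x : W.sha, (p : ℤ) • x = 0 → x = 0) →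
      (∀ t : ℚ, W.entireLFunction 1 / (W.realPeriodRat : ℂ) = (t : ℂ) → padicValRat p t ≠ 0) →
      MissingUpperBoundAt W p) :
    PrintX11a.UpperNonSurjFive := by
  refine upperNonSurjFive_of_unitSector_of_shallow_of_threeCores hU hS (fun W _ _ p _ hX hns hp5 hsp => ?_) hCx hCt
  by_cases hSha : ∀ x : W.sha, (p : ℤ) • x = 0 → x = 0
  · by_cases htam : padicValNat p W.tamagawaProduct ≤ 1
    · exact hE W p hX hns hp5 hsp htam hSha
    · exact hCe W p hX hns hp5 hsp (Or.inr (by omega))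
  · push Not at hSha
    exact hCe W p hX hns hp5 hsp (Or.inl hSha)

/-- **PLANNER TURNKEY (CONDITIONAL on eleven named facts): the facts + the three FLAT cores ⟹ U5 BY NAME** — UNIT from `upperNonSurjFive_on_unitSector_of_eightFacts`
(p671927), SHALLOW from `upperNonSurjFive_on_shallowSector_of_nineFacts` (p677281), EXC-SHALLOW from `Exc.upperNonSurjFive_on_excShallowSector_of_facts` (p686445).
Facts: Stein–Wuthrich 6.1 ×2, Kato 12.4, modularity, Kato §17.13 V′/VI′/XI′, Mazur 1978 Cor. 4.1, GZK, Coleman–Edixhoven 1998 Thm. 2.1, Greenberg–Vatsal 2000 §3, Ribet 1984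
Thm. 4.1 (Ihara), and `ribet1990_levelLowering_gamma0_newform_general_of_five_le` (Darmon–Diamond–Taylor Thm. 3.15 at `p ≥ 5`).
[cite: Kato2004Asterisque, §17.13 (pp. 279–280)] [cite: DarmonDiamondTaylor1995, Thm. 3.15] [cite: GreenbergVatsal2000, §3 (17)–(19)] [cite: Miller2011LMS, Def. 1.1] -/
theorem upperNonSurjFive_of_elevenFacts_of_threeFlatCores
    (hJs : thm61_splitMultiplicative) (hJn : thm61_nonsplitMultiplicative)
    (h12 : Kato2004.thm12_4) (hnf : exists_isNewformOf)
    (hns' : Kato2004.exists_multDivisibilityInputs_nonsplit_contra)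
    (hsp' : Kato2004.exists_multDivisibilityInputs_split_contra)
    (hfine' : Kato2004.exists_multDivisibilityInputs_fine_contra) (hMz : mazur_not_dvd_maninConstant_of_odd)
    (hGZK : rank_eq_analyticRank_of_analyticRank_le_one)
    (hCE : colemanEdixhoven1998_heckePolynomial_simpleRoots)
    (hGV : greenbergVatsal2000_plusSymbol_congruence) (hI : ribet1984_iharaLemma)
    (hLL : ribet1990_levelLowering_gamma0_newform_general_of_five_le)
    (hCe : ∀ (W : WeierstrassCurve ℚ) [W.IsElliptic] [W.IsGloballyMinimal] (p : ℕ) [Fact p.Prime],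
      ClassX11a W p → ¬ Surj W p → 5 ≤ p → W.HasSplitMultiplicativeReductionAtPrime p →
      ((∃ x : W.sha, (p : ℤ) • x = 0 ∧ x ≠ 0) ∨ 2 ≤ padicValNat p W.tamagawaProduct) → MissingUpperBoundAt W p)
    (hCx : ∀ (W : WeierstrassCurve ℚ) [W.IsElliptic] [W.IsGloballyMinimal] (p : ℕ) [Fact p.Prime],
      ClassX11a W p → ¬ Surj W p → 5 ≤ p → ¬ W.HasSplitMultiplicativeReductionAtPrime p →
      (∃ x : W.sha, (p : ℤ) • x = 0 ∧ x ≠ 0) →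
      (∀ t : ℚ, W.entireLFunction 1 / (W.realPeriodRat : ℂ) = (t : ℂ) → padicValRat p t ≠ 0) →
      MissingUpperBoundAt W p)
    (hCt : ∀ (W : WeierstrassCurve ℚ) [W.IsElliptic] [W.IsGloballyMinimal] (p : ℕ) [Fact p.Prime],
      ClassX11a W p → ¬ Surj W p → 5 ≤ p → ¬ W.HasSplitMultiplicativeReductionAtPrime p →
      2 ≤ padicValNat p W.tamagawaProduct → (∀ x : W.sha, (p : ℤ) • x = 0 → x = 0) →
      (∀ t : ℚ, W.entireLFunction 1 / (W.realPeriodRat : ℂ) = (t : ℂ) → padicValRat p t ≠ 0) →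
      MissingUpperBoundAt W p) :
    PrintX11a.UpperNonSurjFive :=
  upperNonSurjFive_of_sectors_of_threeFlatCores
    (upperNonSurjFive_on_unitSector_of_eightFacts hJs hJn h12 hnf hns' hsp' hfine' hMz)
    (upperNonSurjFive_on_shallowSector_of_nineFacts hJs hJn h12 hnf hns' hsp' hfine' hMz hGZK)
    (Exc.upperNonSurjFive_on_excShallowSector_of_facts hCE hGV hI hMz hnf hLL hGZK) hCe hCx hCt

/-! ## §2 Exactness (fact-free) -/

/-- **Rev 10's C_exc ⟺ EXC-SHALLOW ∧ C_exc♭ (fact-free)**: each is C_exc on a sub-locus, and together they cover it. [cite: Miller2011LMS, Def. 1.1] -/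
theorem excZeroCore_iff_excShallow_and_flat :
    (∀ (W : WeierstrassCurve ℚ) [W.IsElliptic] [W.IsGloballyMinimal] (p : ℕ) [Fact p.Prime],
        ClassX11a W p → ¬ Surj W p → 5 ≤ p → W.HasSplitMultiplicativeReductionAtPrime p → MissingUpperBoundAt W p) ↔
      ((∀ (W : WeierstrassCurve ℚ) [W.IsElliptic] [W.IsGloballyMinimal] (p : ℕ) [Fact p.Prime],
          ClassX11a W p → ¬ Surj W p → 5 ≤ p → W.HasSplitMultiplicativeReductionAtPrime p →
          padicValNat p W.tamagawaProduct ≤ 1 → (∀ x : W.sha, (p : ℤ) • x = 0 → x = 0) → MissingUpperBoundAt W p) ∧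
        (∀ (W : WeierstrassCurve ℚ) [W.IsElliptic] [W.IsGloballyMinimal] (p : ℕ) [Fact p.Prime],
          ClassX11a W p → ¬ Surj W p → 5 ≤ p → W.HasSplitMultiplicativeReductionAtPrime p →
          ((∃ x : W.sha, (p : ℤ) • x = 0 ∧ x ≠ 0) ∨ 2 ≤ padicValNat p W.tamagawaProduct) → MissingUpperBoundAt W p)) := by
  refine ⟨fun h => ⟨fun W _ _ p _ hX hns hp5 hsp _ _ => h W p hX hns hp5 hsp, fun W _ _ p _ hX hns hp5 hsp _ => h W p hX hns hp5 hsp⟩,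
    fun ⟨hE, hCe⟩ W _ _ p _ hX hns hp5 hsp => ?_⟩
  by_cases hSha : ∀ x : W.sha, (p : ℤ) • x = 0 → x = 0
  · by_cases htam : padicValNat p W.tamagawaProduct ≤ 1
    · exact hE W p hX hns hp5 hsp htam hSha
    · exact hCe W p hX hns hp5 hsp (Or.inr (by omega))
  · push Not at hSha
    exact hCe W p hX hns hp5 hsp (Or.inl hSha)

/-- **Exactness of the rev-11 cut (fact-free):** U5 ⟺ UNIT ∧ SHALLOW ∧ EXC-SHALLOW ∧ C_exc♭ ∧ C_exp ∧ C_tam. [cite: Miller2011LMS, Def. 1.1 (arXiv:1010.2431 p. 3)] -/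
theorem upperNonSurjFive_iff_sectors_and_threeFlatCores :
    PrintX11a.UpperNonSurjFive ↔
      ((∀ (W : WeierstrassCurve ℚ) [W.IsElliptic] [W.IsGloballyMinimal] (p : ℕ) [Fact p.Prime],
          ClassX11a W p → ¬ Surj W p → 5 ≤ p → ¬ W.HasSplitMultiplicativeReductionAtPrime p →
          (∃ t : ℚ, W.entireLFunction 1 / (W.realPeriodRat : ℂ) = (t : ℂ) ∧ padicValRat p t = 0) →
          MissingUpperBoundAt W p) ∧
        (∀ (W : WeierstrassCurve ℚ) [W.IsElliptic] [W.IsGloballyMinimal] (p : ℕ) [Fact p.Prime],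
          ClassX11a W p → ¬ Surj W p → 5 ≤ p → ¬ W.HasSplitMultiplicativeReductionAtPrime p →
          padicValNat p W.tamagawaProduct ≤ 1 → (∀ x : W.sha, (p : ℤ) • x = 0 → x = 0) → MissingUpperBoundAt W p) ∧
        (∀ (W : WeierstrassCurve ℚ) [W.IsElliptic] [W.IsGloballyMinimal] (p : ℕ) [Fact p.Prime],
          ClassX11a W p → ¬ Surj W p → 5 ≤ p → W.HasSplitMultiplicativeReductionAtPrime p →
          padicValNat p W.tamagawaProduct ≤ 1 → (∀ x : W.sha, (p : ℤ) • x = 0 → x = 0) → MissingUpperBoundAt W p) ∧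
        (∀ (W : WeierstrassCurve ℚ) [W.IsElliptic] [W.IsGloballyMinimal] (p : ℕ) [Fact p.Prime],
          ClassX11a W p → ¬ Surj W p → 5 ≤ p → W.HasSplitMultiplicativeReductionAtPrime p →
          ((∃ x : W.sha, (p : ℤ) • x = 0 ∧ x ≠ 0) ∨ 2 ≤ padicValNat p W.tamagawaProduct) → MissingUpperBoundAt W p) ∧
        (∀ (W : WeierstrassCurve ℚ) [W.IsElliptic] [W.IsGloballyMinimal] (p : ℕ) [Fact p.Prime],
          ClassX11a W p → ¬ Surj W p → 5 ≤ p → ¬ W.HasSplitMultiplicativeReductionAtPrime p →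
          (∃ x : W.sha, (p : ℤ) • x = 0 ∧ x ≠ 0) →
          (∀ t : ℚ, W.entireLFunction 1 / (W.realPeriodRat : ℂ) = (t : ℂ) → padicValRat p t ≠ 0) →
          MissingUpperBoundAt W p) ∧
        (∀ (W : WeierstrassCurve ℚ) [W.IsElliptic] [W.IsGloballyMinimal] (p : ℕ) [Fact p.Prime],
          ClassX11a W p → ¬ Surj W p → 5 ≤ p → ¬ W.HasSplitMultiplicativeReductionAtPrime p →
          2 ≤ padicValNat p W.tamagawaProduct → (∀ x : W.sha, (p : ℤ) • x = 0 → x = 0) →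
          (∀ t : ℚ, W.entireLFunction 1 / (W.realPeriodRat : ℂ) = (t : ℂ) → padicValRat p t ≠ 0) →
          MissingUpperBoundAt W p)) :=
  ⟨fun h => ⟨fun W _ _ p _ hX hns hp5 _ _ => h W p hX hns hp5, fun W _ _ p _ hX hns hp5 _ _ _ => h W p hX hns hp5,
      fun W _ _ p _ hX hns hp5 _ _ _ => h W p hX hns hp5, fun W _ _ p _ hX hns hp5 _ _ => h W p hX hns hp5,
      fun W _ _ p _ hX hns hp5 _ _ _ => h W p hX hns hp5, fun W _ _ p _ hX hns hp5 _ _ _ _ => h W p hX hns hp5⟩,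
    fun h => upperNonSurjFive_of_sectors_of_threeFlatCores h.1 h.2.1 h.2.2.1 h.2.2.2.1 h.2.2.2.2.1 h.2.2.2.2.2⟩

end Summit.BirchSwinnertonDyer.BirchSwinnertonDyer.Theorems.GL1Cartan

end
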